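import Literature.Topology.FourManifolds.CerfTheoremOne
import Literature.Topology.FourManifolds.EquidimensionalEmbedding
import HarnessLib

/-!
# `cerf_isotopy_sphere_three` is equivalent to Cerf's Théorème 1 (`π₀(Diff⁺ S³) = 0`)

Topic `Literature/Topology/FourManifolds`; sibling proof file of `CerfGammaFour.lean` for the named
fact `Literature.Topology.FourManifolds.cerf_isotopy_sphere_three` ("among any three
self-diffeomorphisms of `S³` two are smoothly isotopic", i.e. `π₀ Diff(S³)` has at most two
elements; provefact triage `XL`). Everything in this file is **proved**; no new named fact.

Source. J. Cerf, *Sur les difféomorphismes de la sphère de dimension trois (Γ₄ = 0)*, LNM 53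
(1968), Ch. I §1: « On désigne par `Diff Sⁿ` … le groupe des difféomorphismes de `Sⁿ` … *qui
conservent l'orientation*. On munit ces groupes de la topologie `C^∞` » (its identity component
is its component by *arcs différentiables*), and **Théorème 1.** « Le groupe `π₀(Diff S³)` est
nul. » The tree carries Théorème 1 as the named fact `cerf_pi0Diff_sphere_three`
(`RadialExtension.lean`), in the orientation-free paraphrase "every diffeomorphism of `S³` is
diffeotopic to the identity or to a hyperplane reflection" — which is equivalent to the printed,
oriented reading "every orientation-preserving diffeomorphism of `S³` is diffeotopic to the
identity" (`CerfTheoremOne.lean`: a hyperplane reflection reverses orientation and the orientation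
character is a diffeotopy invariant) — derives `cerf_isotopy_sphere_three` from it
(`cerf_isotopy_sphere_three_of_pi0Diff`) and reduces it to Cerf's statement (2) of Ch. I §2,
`π₀(Diff(D³; S²)) = 0` (`cerf_pi0DiffDisc_relBoundary_three`, `CerfPropositionFour.lean`), the
single unproved leaf (Chapters II–VI of the monograph; Hatcher, Ann. of Math. 117 (1983)).

This file supplies the **converse** reduction, so far only asserted in prose
(`EquidimensionalEmbedding.lean`, introduction): the isotopy form implies the paraphrase, hence
(through the tree's proved chain) both forms of Corollaire 1 (`Γ₄ = 0`):

* `cerf_pi0Diff_sphere_three_of_isotopy : cerf_isotopy_sphere_three → cerf_pi0Diff_sphere_three`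
  — apply the hypothesis to the triple `(φ, id, ρ)`, `ρ = sphereReflection v`; the middle
  alternative "`id` isotopic to `ρ`" is excluded because a hyperplane reflection of `𝕊³` reverses
  orientation and so is not diffeotopic to the identity
  (`not_isDiffeotopic_refl_sphereReflection`, `CerfTheoremOne.lean`; Hirsch, *Differential
  Topology* (1976), Ch. 4 §4 and Ch. 8 §1, Exercise 7(a)), and "smoothly isotopic through
  embeddings" is "diffeotopic" for diffeomorphisms of the closed connected `𝕊³`
  (`Diffeomorph.IsIsotopic.isDiffeotopic`, `EquidimensionalEmbedding.lean`);
* `cerf_isotopy_sphere_three_iff_pi0Diff` — **the named fact `cerf_isotopy_sphere_three` is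
  equivalent to Cerf's Théorème 1** (in the tree's paraphrase, itself equivalent to the printed
  oriented statement): it is neither weaker nor stronger than the source;
* `isDiffeotopicToId_of_isOrientationPreserving_of_isotopy` — in particular the isotopy form gives
  Théorème 1 *as printed*: every orientation-preserving diffeomorphism of `𝕊³` is diffeotopic to
  the identity;
* `cerf_diffeomorph_sphere_three_extends_ball_of_isotopy`, `cerf_twistedSphere_four_of_isotopy` —
  the isotopy form implies `Γ₄ = 0` in extension form (every diffeomorphism of `S³` extends over
  `D⁴`, `CerfGammaFourProofs.lean`) and in twisted-sphere form (`cerf_twistedSphere_four`, the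
  other named fact of `CerfGammaFour.lean`), so a consumer holding
  `(h : cerf_isotopy_sphere_three)` obtains every Cerf statement of the tree;
* `isIsotopic_refl_xor_isIsotopic_sphereReflection_of_isotopy` — with the lower bound
  `[id] ≠ [ρ]`: under `cerf_isotopy_sphere_three`, **`π₀ Diff(S³)` has exactly two elements**,
  every diffeomorphism of `𝕊³` being smoothly isotopic to exactly one of `id`, `ρ`
  (Cerf, Ch. I §1: `π₀` of all diffeomorphisms is `π₀ O(4) = ℤ/2`, cf. Corollaire 2).

## References

* J. Cerf, *Sur les difféomorphismes de la sphère de dimension trois (Γ₄ = 0)*, Lecture Notes in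
  Mathematics 53, Springer (1968), Ch. I §1 (conventions; Théorème 1; Corollaires 1, 2), Ch. I §2
  (statement (2)). [CerfDiffeoSphere1968] (interim key [Cerf1968] in `CerfGammaFour.lean`)
* M. W. Hirsch, *Differential Topology*, GTM 33, Springer (1976), Ch. 4 §4 (reflections of `Sⁿ`
  reverse orientation), Ch. 8 §1 (isotopy, diffeotopy; Exercise 7(a)). [HirschDT1976]

## Design notes

* Only theorems are added; the imports are `CerfTheoremOne.lean` (hyperplane reflections are not
  diffeotopic to the identity; it already carries the proved chain `RadialExtension`,
  `BallGluingUniqueness`) and `EquidimensionalEmbedding.lean`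
  (`Diffeomorph.IsIsotopic.isDiffeotopic`).
* No separate named fact for the printed (oriented) reading of Théorème 1 is kept in the tree: an
  equivalent restatement of `cerf_pi0Diff_sphere_three` / `cerf_isotopy_sphere_three` is not a
  separate obligation (review 2026-08-15, D-0026); the oriented statement is a *theorem* from the
  leaf (`CerfTheoremOneProofs.lean`) and from the paraphrase (`CerfTheoremOne.lean`).
* `ConnectedSpace S³` is produced locally from `isConnected_sphere`, as in `CerfTheoremOne.lean`
  (no global instance is declared); no notation is introduced: the sphere is written
  `Metric.sphere (0 : EuclideanSpace ℝ (Fin 4)) 1`, as in `CerfGammaFour.lean`.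
-/

open scoped Manifold ContDiff Topology
open Set Function Metric Module

noncomputable section

namespace Literature.Topology.FourManifolds

/-- The round `3`-sphere is connected (`isConnected_sphere` in `ℝ⁴`, `1 < dim`). [folklore] -/
theorem connectedSpace_sphere_three :
    ConnectedSpace (Metric.sphere (0 : EuclideanSpace ℝ (Fin 4)) 1) := by
  refine isConnected_iff_connectedSpace.mp (isConnected_sphere ?_ 0 zero_le_one)
  rw [← Module.finrank_eq_rank, finrank_euclideanSpace_fin]
  norm_num

/-! ### The isotopy form implies the orientation-free paraphrase of Théorème 1 -/

/-- **`cerf_isotopy_sphere_three` implies Cerf's Théorème 1 in its orientation-free paraphrase**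
`cerf_pi0Diff_sphere_three` (`RadialExtension.lean`): if among any three self-diffeomorphisms of
`S³` two are smoothly isotopic, then every diffeomorphism `φ` of `𝕊³` is diffeotopic to the
identity or to the hyperplane reflection `ρ = sphereReflection v`. Apply the hypothesis to
`(φ, id, ρ)`: the alternative "`id` isotopic to `ρ`" contradicts
`not_isDiffeotopic_refl_sphereReflection` (a reflection reverses orientation, Hirsch Ch. 4 §4),
and in the two remaining alternatives isotopy through embeddings of the closed connected `𝕊³` is
diffeotopy (`Diffeomorph.IsIsotopic.isDiffeotopic`). Converse:
`cerf_isotopy_sphere_three_of_pi0Diff`. [cite: CerfDiffeoSphere1968, Ch. I §1, Théorème 1] -/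
theorem cerf_pi0Diff_sphere_three_of_isotopy (h : cerf_isotopy_sphere_three) :
    cerf_pi0Diff_sphere_three := by
  intro v φ
  haveI := connectedSpace_sphere_three
  rcases h φ (Diffeomorph.refl (𝓡 3) _ ∞) (sphereReflection v) with h1 | h1 | h1
  · -- `φ` isotopic to `id`
    refine Or.inl ((Diffeomorph.isDiffeotopic_refl_iff φ).mp ?_)
    exact (Diffeomorph.IsIsotopic.isDiffeotopic (φ := φ) (ψ := Diffeomorph.refl (𝓡 3) _ ∞)
      h1).symm
  · -- `id` isotopic to `ρ`: impossible, `ρ` reverses orientation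
    exact absurd (Diffeomorph.IsIsotopic.isDiffeotopic (φ := Diffeomorph.refl (𝓡 3) _ ∞)
      (ψ := sphereReflection v) h1) (not_isDiffeotopic_refl_sphereReflection three_ne_zero v)
  · -- `φ` isotopic to `ρ`
    exact Or.inr (Diffeomorph.IsIsotopic.isDiffeotopic (φ := φ) (ψ := sphereReflection v)
      h1).symm

/-- **The named fact `cerf_isotopy_sphere_three` is equivalent to Cerf's Théorème 1 in
paraphrase** (`cerf_pi0Diff_sphere_three`: every diffeomorphism of `S³` is diffeotopic to `id` or
to a reflection). [cite: CerfDiffeoSphere1968, Ch. I §1, Théorème 1] -/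
theorem cerf_isotopy_sphere_three_iff_pi0Diff :
    cerf_isotopy_sphere_three ↔ cerf_pi0Diff_sphere_three :=
  ⟨cerf_pi0Diff_sphere_three_of_isotopy, cerf_isotopy_sphere_three_of_pi0Diff⟩

/-! ### The isotopy form gives Théorème 1 in its printed, oriented reading -/

/-- **`cerf_isotopy_sphere_three` implies Cerf's Théorème 1 as printed** (`π₀(Diff⁺ S³) = 0` in
the convention of Ch. I §1, `Diff` = orientation-preserving diffeomorphisms): every
self-diffeomorphism `φ` of `𝕊³` preserving a smooth orientation `o` is diffeotopic to the
identity. By `cerf_pi0Diff_sphere_three_of_isotopy`, `φ ~ id` or `φ ~ ρ`, `ρ` a hyperplane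
reflection; in the second case `ρ` would preserve `o` like `φ`
(`Diffeomorph.IsDiffeotopic.isOrientationPreserving_iff`, `OrientationDiffeotopy.lean`: the
orientation character is constant along a diffeotopy), whereas a hyperplane reflection of `𝕊³`
reverses every orientation (`sphereReflection_isOrientationReversing_of_ne_zero`,
`CerfTheoremOne.lean`). [cite: CerfDiffeoSphere1968, Ch. I §1, Théorème 1] -/
theorem isDiffeotopicToId_of_isOrientationPreserving_of_isotopy (h : cerf_isotopy_sphere_three)
    (o : SmoothOrientation (𝓡 3) (Metric.sphere (0 : EuclideanSpace ℝ (Fin 4)) 1))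
    (φ : (Metric.sphere (0 : EuclideanSpace ℝ (Fin 4)) 1) ≃ₘ⟮𝓡 3, 𝓡 3⟯
      (Metric.sphere (0 : EuclideanSpace ℝ (Fin 4)) 1))
    (hφ : φ.IsOrientationPreserving o o) : Diffeomorph.IsDiffeotopicToId φ := by
  rcases cerf_pi0Diff_sphere_three_of_isotopy h (sphereBasePoint 3) φ with h1 | h1
  · exact h1
  · exfalso
    haveI : Nonempty (Metric.sphere (0 : EuclideanSpace ℝ (Fin 4)) 1) := ⟨sphereBasePoint 3⟩
    exact ((h1.isOrientationPreserving_iff o o).mpr hφ).not_isOrientationReversing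
      (sphereReflection_isOrientationReversing_of_ne_zero three_ne_zero (sphereBasePoint 3) o)

/-! ### The isotopy form implies `Γ₄ = 0` (Corollaire 1) in both forms of the tree -/

/-- **`cerf_isotopy_sphere_three` implies `Γ₄ = 0` in extension form**: every self-diffeomorphism
of `S³ = ∂D⁴` extends to a self-diffeomorphism of `D⁴`
(`cerf_diffeomorph_sphere_three_extends_ball`, `CerfGammaFourProofs.lean`) — Cerf's deduction
"Théorème 1 ⇒ Corollaire 1" by Lemme 2 (`cerf_diffeomorph_sphere_three_extends_ball_of_pi0Diff`,
`RadialExtension.lean`). [cite: CerfDiffeoSphere1968, Ch. I §1, Corollaire 1] -/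
theorem cerf_diffeomorph_sphere_three_extends_ball_of_isotopy (h : cerf_isotopy_sphere_three) :
    cerf_diffeomorph_sphere_three_extends_ball :=
  cerf_diffeomorph_sphere_three_extends_ball_of_pi0Diff (cerf_pi0Diff_sphere_three_of_isotopy h)

/-- **`cerf_isotopy_sphere_three` implies `cerf_twistedSphere_four`** (the other named fact of
`CerfGammaFour.lean`: every twisted 4-sphere `D⁴ ∪_φ D⁴` is diffeomorphic to `S⁴`), through
`cerf_twistedSphere_four_of_pi0Diff'` (`BallGluingUniqueness.lean`, which discharges uniqueness of
the gluing `D⁴ ∪ D⁴`). So the isotopy form requested by route `SmoothPoincare4/SchoenfliesSplit`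
also delivers the twisted-sphere hypothesis of its assembly.
[cite: CerfDiffeoSphere1968, Ch. I §1, Théorème 1 with Corollaire 1 (Γ₄ = 0)] -/
theorem cerf_twistedSphere_four_of_isotopy (h : cerf_isotopy_sphere_three) :
    cerf_twistedSphere_four :=
  cerf_twistedSphere_four_of_pi0Diff' (cerf_pi0Diff_sphere_three_of_isotopy h)

/-! ### Exactly two isotopy classes -/

/-- **Under `cerf_isotopy_sphere_three`, `π₀ Diff(S³)` has exactly two elements**: every
self-diffeomorphism of `𝕊³` is smoothly isotopic (through embeddings, `Diffeomorph.IsIsotopic`,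
`Isotopy.lean`) to exactly one of the identity and the hyperplane reflection
`sphereReflection v`. "At least one" is the hypothesis in the form
`cerf_pi0Diff_sphere_three_of_isotopy` (diffeotopic diffeomorphisms are isotopic,
`Diffeomorph.IsDiffeotopic.isIsotopic`); "at most one" is the lower bound `[id] ≠ [ρ]`
(`not_isDiffeotopic_refl_sphereReflection`: a reflection reverses orientation), independent of
Cerf's theorem. Cerf (1968), Ch. I §1 (with all diffeomorphisms, `π₀ Diff(S³) ≅ π₀ O(4) = ℤ/2`).
[cite: CerfDiffeoSphere1968, Ch. I §1, Théorème 1] -/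
theorem isIsotopic_refl_xor_isIsotopic_sphereReflection_of_isotopy
    (h : cerf_isotopy_sphere_three) (v : Metric.sphere (0 : EuclideanSpace ℝ (Fin 4)) 1)
    (φ : (Metric.sphere (0 : EuclideanSpace ℝ (Fin 4)) 1) ≃ₘ⟮𝓡 3, 𝓡 3⟯
      (Metric.sphere (0 : EuclideanSpace ℝ (Fin 4)) 1)) :
    Xor (Diffeomorph.IsIsotopic (Diffeomorph.refl (𝓡 3) _ ∞) φ)
      (Diffeomorph.IsIsotopic (sphereReflection v) φ) := by
  haveI := connectedSpace_sphere_three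
  -- the two classes are distinct: `id` and `ρ` are not diffeotopic
  have hne : ¬ (Diffeomorph.IsIsotopic (Diffeomorph.refl (𝓡 3) _ ∞) φ ∧
      Diffeomorph.IsIsotopic (sphereReflection v) φ) := by
    rintro ⟨h1, h2⟩
    exact not_isDiffeotopic_refl_sphereReflection three_ne_zero v
      ((Diffeomorph.IsIsotopic.isDiffeotopic h1).trans
        (Diffeomorph.IsIsotopic.isDiffeotopic h2).symm)
  rcases cerf_pi0Diff_sphere_three_of_isotopy h v φ with h1 | h1
  · have h1' : Diffeomorph.IsIsotopic (Diffeomorph.refl (𝓡 3) _ ∞) φ :=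
      Diffeomorph.IsDiffeotopic.isIsotopic ((Diffeomorph.isDiffeotopic_refl_iff φ).mpr h1)
    exact Or.inl ⟨h1', fun h2 => hne ⟨h1', h2⟩⟩
  · have h1' : Diffeomorph.IsIsotopic (sphereReflection v) φ :=
      Diffeomorph.IsDiffeotopic.isIsotopic h1
    exact Or.inr ⟨h1', fun h2 => hne ⟨h2, h1'⟩⟩

end Literature.Topology.FourManifolds

end
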